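import Literature.Geometry.Kaehler.ComplexTorusTypeOfPolarization
import HarnessLib

/-!
# REVIEW-RUNBOOK sanity lemmas — the complex-torus foundations' hypothesis telescopes are met by the elliptic curve `ℂ/(ℤi + ℤ)`
# (client `lit-hodgefound` of the ops review-runbook generator, cards S1 / S2 / S4)

Card (2)(b) («non-vacuity») of the Hodge-foundations runbook.  Three typed statements of
`Literature/Geometry/Kaehler/` quantify over a complex torus `E/Φ(ℤ^ι)` with a RIEMANN FORM (`IsRiemannForm`: type
`(1,1)`, integral on the lattice, positive), a POLARIZATION TYPE (`IsPolarizationType Φ η d`: a symplectic lattice basis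
with elementary divisors `d`), an ABELIAN VARIETY (`IsAbelianVariety`: some Riemann form exists) or the rational Gram
matrix of the form (`G.map Rat.cast = latticeGram Φ η`).  Whether these predicates — as DEFINED in the tree — are met by
anything at all is what box b asks; the tree's own elliptic curve `ℂ/(ℤτ + ℤ)` at `τ = i` (`ComplexTorusEllipticCurve.lean`:
`ellipticPeriod`, `ellipticForm = Im(v w̄)/Im τ`, `isRiemannForm_ellipticForm`, `isPrincipalPolarization_elliptic`,
`latticeGram_elliptic = (0 1; −1 0)`, `isAbelianVariety_elliptic`) meets every one of them, and this file records the
three telescopes as closed theorems `∃ objects, h₁ ∧ … ∧ hₙ` (the shape the generator's probe matches):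

* `IsRiemannForm.torusIntegral_wedgePow_neg_of_isPolarizationType` (S1): a Riemann form WITH a polarization type —
  `ellipticForm` is principal, hence of type `(1)` (`IsPrincipalPolarization.exists_type_eq_one`);
* `IsAbelianVariety.exists_projectiveEmbedding` (S2): a finite-dimensional `E` carrying an abelian variety — `E = ℂ`;
* `abelianSubvarietyEquivSymmIdempotent` (S4): a Riemann form whose lattice Gram matrix is a rational matrix — `(0 1; −1 0)`.

Non-degenerate (a genuine principally polarized elliptic curve).  Review evidence only (topic module, closes no item);
no definitions, no `sorry`, standard axioms.
-/

namespace Summit.HodgeConjecture.HodgeCM.Runbook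

open Literature.Geometry.Kaehler Literature.Geometry.Kaehler.ComplexTorus

/-- `Im i = 1 > 0`. [folklore] -/
theorem I_im_pos : 0 < Complex.I.im := by simp

/-- (b) **The two hypotheses of `IsRiemannForm.torusIntegral_wedgePow_neg_of_isPolarizationType` hold together**: on the
elliptic curve `ℂ/(ℤi + ℤ)` (`Φ = ellipticPeriod`, `τ = i`) the form `η = ellipticForm` (`Im(v w̄)`) is a Riemann form
(`isRiemannForm_ellipticForm`) AND has a polarization type `d` (it is principal: `isPrincipalPolarization_elliptic`, so of type
`(1, …, 1)` by `IsPrincipalPolarization.exists_type_eq_one`). [folklore] -/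
theorem torusIntegral_wedgePow_neg_of_isPolarizationType_hypotheses :
    ∃ (η : ℂ [⋀^Fin 2]→L[ℝ] ℝ) (g : ℕ) (d : Fin g → ℕ),
      IsRiemannForm (ellipticPeriod I_im_pos.ne') η ∧ IsPolarizationType (ellipticPeriod I_im_pos.ne') η d := by
  obtain ⟨g, d, hd, -⟩ := (isPrincipalPolarization_elliptic I_im_pos).exists_type_eq_one
  exact ⟨_, g, d, isRiemannForm_ellipticForm I_im_pos, hd⟩

/-- (b) **The two hypotheses of `IsAbelianVariety.exists_projectiveEmbedding` hold together**: `E = ℂ` is finite-dimensional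
over `ℂ` and the elliptic curve `ℂ/(ℤi + ℤ)` (`Φ = ellipticPeriod`) is an abelian variety (`isAbelianVariety_elliptic`). [folklore] -/
theorem exists_projectiveEmbedding_hypotheses :
    ∃ Φ : (Fin 2 → ℝ) ≃L[ℝ] ℂ, FiniteDimensional ℂ ℂ ∧ IsAbelianVariety Φ :=
  ⟨ellipticPeriod I_im_pos.ne', inferInstance, isAbelianVariety_elliptic I_im_pos⟩

/-- (b) **The two hypotheses of `abelianSubvarietyEquivSymmIdempotent` hold together**: on `ℂ/(ℤi + ℤ)` the Riemann form
`ellipticForm` (`isRiemannForm_ellipticForm`) has the RATIONAL (indeed integral) lattice Gram matrix `G = (0 1; −1 0)`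
(`latticeGram_elliptic`). [folklore] -/
theorem abelianSubvarietyEquivSymmIdempotent_hypotheses :
    ∃ (η : ℂ [⋀^Fin 2]→L[ℝ] ℝ) (G : Matrix (Fin 2) (Fin 2) ℚ),
      IsRiemannForm (ellipticPeriod I_im_pos.ne') η ∧ G.map Rat.cast = latticeGram (ellipticPeriod I_im_pos.ne') η := by
  refine ⟨ellipticForm I_im_pos.ne', !![0, 1; -1, 0], isRiemannForm_ellipticForm I_im_pos, ?_⟩
  rw [latticeGram_elliptic]
  ext i j
  fin_cases i <;> fin_cases j <;> simp

end Summit.HodgeConjecture.HodgeCM.Runbook
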